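import Summits.QuantumFields.BalabanUV.T4Continuum.Support.NE7SliceIterationStateFactsNL
import Summits.QuantumFields.BalabanUV.T4Continuum.Support.NE7SliceDoubleBar
import HarnessLib

/-!
# NE7SliceRepresentativeDbar — AT A STATE WITH (1.37) EXACTLY (`mlog v_{k+1}(X(u)) = h(u)`, the fixed point of the (R1″) frame-free engine `NE7SliceTheoremNL0`):
# (i) the double-bar average of the chart is `1` ([B8]'s `hdbar`), (ii) the NL coarse datum IS the linearised double-bar average, `φ̃(u) = QbarIter L (k+1) W X(u)` (memo ROAD-G103 §6, END step (C4)-1)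

Cell `pub-balaban`, rung (B)+1 sub-cell t4, lineage `b2b-balaban-t4-ne7-p1`, generation 103 (CRUX PROVER NE7 #1 = OWNER of BINDER row NE7).  Memo `t4/b2b-balaban-t4-ne7-p1-g103/ROAD-G103.md` §6.
(i) `NE7SliceDoubleBar.dbavgCovIter_state_eq_one_iff` ([Balaban1985Averaging] (92)∕(159) at the state: `U̿′^{k+1} = 1 ⟺ V^{g} = V`, `g = v_{k+1}⁻¹·e^{h}`) with `v_{k+1} = e^{h}` from
`mlog v_{k+1} = h` (`MatrixLog.exp_mlog`, `‖v_{k+1} − 1‖ ≤ 64d·M·b < 1` by `NE7FrameDefectLipschitz.norm_vcov_relPert_sub_one_le` = [B8] (163)) — so the hypothesis `hdbar` of the k-free letters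
`Spine/NE3/RemainderTowerB8.sqrt_l2sq_QbarIter_le` ∕ `RemainderL1FinalB8.dirL1_QbarIter_le_quadratic` holds at the representative (`relPert = expCfg ∘ adField`, `NE3.QbarDictionary.relPert_eq_expCfg_adField`).
(ii) `φ̃ = dirIter X − gaugeDir_V h̃`, `h̃ = h − P`, `P = mlog v_{k+1}(X) − framePotW X` ⟹ at such a state `h̃ = framePotW X` and `φ̃ = dirIter X − gaugeDir_V (framePotW X) = QbarIter X`
(`NE3TangentCovariantTower.dirIter_eq_QbarIter_add_gaugeDir`).
WHAT ([folklore]; 0 def, 0 sorry).  `vcov_eq_expUnit_of_mlog_eq`, **`dbavgCovIter_eq_one_of_mlog_vcov_eq`**, `dbavgCovIter_expCfg_eq_one_of_mlog_vcov_eq`, `effCornerLog_eq_framePotW_of_mlog_vcov_eq`,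
**`coarseDatumNL_eq_QbarIter_of_mlog_vcov_eq`**.
HONEST FRAMING (page 1): bookkeeping over landed kernel theorems; nothing of Bałaban's asserted; NOT the letters, NOT NE7; spine 0∕9; finite T⁴ rung (B)+1 — NOT infinite volume, NOT mass gap,
NOT BetaPertH, NOT Clay.  Continuum YM on T⁴ ⇐ BetaPertH ∧ nine spine estimates (0/9 proved); BetaPertH ⇐ (D1) ∧ (D4) ∧ CAP+tail; G-an2-4 gates asym, D1 and NE2/3/4.
-/

set_option autoImplicit false

open scoped BigOperators Matrix.Norms.L2Operator
open NormedSpace Finset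

namespace Summit.QuantumFields.BalabanUV.T4Continuum.NE7SliceRepresentativeDbar

open Literature.MathematicalPhysics.QuantumFieldTheory.Balaban1983to89
open B7Prop1Explicit B7Prop2Explicit B7Prop3Flat MatrixLog
open B7Eq92Concrete (vcov dbavgCovIter)
open T4AveragingDeficitWall (IsUnitaryCfg IsSkewDir SmallField vary)
open T4AveragingDeficitWallBoundary (IsPeriodicCfg)
open AveragingDeficitPeriodicCounting (IsPeriodicDir)
open AveragingDeficitMultiLevelPrep (cavgIter LevelSmall tower)
open BlockAveragePushDirGauge (gaugeDir)
open NE3EnergyShapes (IsUnitarySite IsPeriodicSite)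
open NE3TangentCovariantTower (dirIter framePotW QbarIter dirIter_eq_QbarIter_add_gaugeDir)
open NE3.PairLandauB8Avg (relPert)
open NE3.QbarDictionary (adField relPert_eq_expCfg_adField)
open NE7SliceIterationState (repLog cornerLog)
open NE7SliceIterationStateNL (frameDefect effCornerLog coarseDatumNL)
open NE7SliceIterationStateFacts (repLog_skew repLog_periodic)
open NE7FrameDefectLipschitz (norm_vcov_relPert_sub_one_le)
open NE7SliceDoubleBar (dbavgCovIter_state_eq_one_iff)

noncomputable section

variable {d : ℕ} {n : Type*} [Fintype n] [DecidableEq n] [Nonempty n]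

section Dbar

variable {L : ℕ} (hL : 2 ≤ L) (k : ℕ) {W : Site d → Fin d → (Matrix n n ℂ)ˣ} (hWu : IsUnitaryCfg W) (U' : Site d → Fin d → (Matrix n n ℂ)ˣ)
  {α₀ b : ℝ} (hα : 0 < α₀) (hα3 : C0 d * α₀ ≤ 1 / 3) (hα4 : 4 * α₀ ≤ c2' d L) (h52 : pdev W < α₀ * (((L : ℝ) ^ (k + 1))⁻¹) ^ 2)
  (hb : 0 ≤ b) {u : Site d → (Matrix n n ℂ)ˣ} (hXb : ∀ y κ, ‖repLog W U' u y κ‖ ≤ b)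
  (hsmall : Real.exp (4 * (800 * ((d : ℝ) + 1) ^ 2 * ((d : ℝ) + 4)) * α₀) * (1 + 8 * (131072 * ((d : ℝ) + 1) ^ 2) * ((L : ℝ) ^ (k + 1) * b)) ≤ 2)
  (hc₃ : 2 * ((L : ℝ) ^ (k + 1) * b) ≤ c3 d L) (hsm : 2048 * (d : ℝ) * ((L : ℝ) ^ (k + 1) * b) ≤ 1)
  (hv0 : ∀ z, mlog ((vcov L W (relPert W (repLog W U' u)) (k + 1) z : (Matrix n n ℂ)ˣ) : Matrix n n ℂ) = cornerLog L k u z)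

include hL hWu hα hα3 hα4 h52 hb hXb hsmall hc₃ hsm hv0 in
/-- **(1.37) AS AN EQUALITY OF UNITS**: `v_{k+1}(X(u)) z = expUnit (h(u) z)` (`exp ∘ mlog = id` on `‖v − 1‖ ≤ 64d·M·b ≤ 1∕32 < 1`). [cite: Balaban1985RegularSpaces, (1.37) p.82] -/
theorem vcov_eq_expUnit_of_mlog_eq (z : Site d) : vcov L W (relPert W (repLog W U' u)) (k + 1) z = expUnit (cornerLog L k u z) := by
  have hd0 : (0 : ℝ) ≤ d := Nat.cast_nonneg d
  have h1 : ‖((vcov L W (relPert W (repLog W U' u)) (k + 1) z : (Matrix n n ℂ)ˣ) : Matrix n n ℂ) - 1‖ < 1 := by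
    have h := norm_vcov_relPert_sub_one_le hL k hWu hα hα3 hα4 h52 hb hXb hsmall hc₃ hsm z
    have h2 : 64 * (d : ℝ) * ((L : ℝ) ^ (k + 1) * b) ≤ 1 / 32 := by nlinarith only [hsm, hd0]
    linarith only [h, h2]
  ext
  rw [val_expUnit, ← hv0 z, exp_mlog h1]

variable {x' : ℝ} (hU'u : IsUnitaryCfg U') (hx'0 : 0 ≤ x') (hs' : LevelSmall d L k x') (hU'x : SmallField U' x')
  (htop : cavgIter L (k + 1) U' = cavgIter L (k + 1) W) (hu : IsUnitarySite u)
  (hgauge : gaugeAct u U' = vary W (repLog W U' u) 1)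
  (hcorner : ∀ z, ((u (((L : ℤ) ^ (k + 1)) • z) : (Matrix n n ℂ)ˣ) : Matrix n n ℂ) = exp (cornerLog L k u z))

include hL hWu hα hα3 hα4 h52 hb hXb hsmall hc₃ hsm hv0 hU'u hx'0 hs' hU'x htop hu hgauge hcorner in
/-- **THE DOUBLE-BAR AVERAGE OF THE REPRESENTATIVE IS ONE**: `U̿′^{k+1}(X(u)) = dbavgCovIter L W (relPert W X(u)) (k+1) = 1` — [B8]'s `hdbar` at a state with (1.37) exactly, on the (S1) fibre
`cavgIter (k+1) U′ = cavgIter (k+1) W`. [cite: Balaban1985RegularSpaces, (1.37) p.82] -/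
theorem dbavgCovIter_eq_one_of_mlog_vcov_eq : dbavgCovIter L W (relPert W (repLog W U' u)) (k + 1) = 1 := by
  rw [dbavgCovIter_state_eq_one_iff hL k U' hU'u hx'0 hs' hU'x htop hu hgauge hcorner]
  have hg : ((vcov L W (relPert W (repLog W U' u)) (k + 1))⁻¹ * fun w => expUnit (cornerLog L k u w)) = 1 := by
    funext w
    simp only [Pi.mul_apply, Pi.inv_apply, Pi.one_apply, vcov_eq_expUnit_of_mlog_eq hL k hWu U' hα hα3 hα4 h52 hb hXb hsmall hc₃ hsm hv0 w, inv_mul_cancel]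
  rw [hg]
  funext y μ
  simp [gaugeAct]

include hL hWu hα hα3 hα4 h52 hb hXb hsmall hc₃ hsm hv0 hU'u hx'0 hs' hU'x htop hu hgauge hcorner in
/-- the same in the spelling of the B8 letters (`relPert W Z = expCfg (adField W Z)`). [folklore] -/
theorem dbavgCovIter_expCfg_eq_one_of_mlog_vcov_eq : dbavgCovIter L W (expCfg (adField W (repLog W U' u))) (k + 1) = 1 := by
  rw [← relPert_eq_expCfg_adField]
  exact dbavgCovIter_eq_one_of_mlog_vcov_eq hL k hWu U' hα hα3 hα4 h52 hb hXb hsmall hc₃ hsm hv0 hU'u hx'0 hs' hU'x htop hu hgauge hcorner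

end Dbar

/-! ## §2 The NL datum at such a state is `QbarIter X` -/

section Datum

variable {L : ℕ} (hL : 2 ≤ L) (k : ℕ) {W : Site d → Fin d → (Matrix n n ℂ)ˣ} {x : ℝ} (hWu : IsUnitaryCfg W) (hx : 0 ≤ x) (hs : LevelSmall d L k x)
  (hWx : SmallField W x) (N : ℕ) [NeZero N] (U' : Site d → Fin d → (Matrix n n ℂ)ˣ)
  (hWP : IsPeriodicCfg W ((tower L N (k + 1) : ℕ) : ℤ)) (hU'u : IsUnitaryCfg U') (hU'P : IsPeriodicCfg U' ((tower L N (k + 1) : ℕ) : ℤ))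
  {u : Site d → (Matrix n n ℂ)ˣ} (hu : IsUnitarySite u) (huP : IsPeriodicSite u ((tower L N (k + 1) : ℕ) : ℤ))
  (hgauge : gaugeAct u U' = vary W (repLog W U' u) 1) (hX8 : ∀ y κ, ‖repLog W U' u y κ‖ ≤ 1 / 8)
  (hv0 : ∀ z, mlog ((vcov L W (relPert W (repLog W U' u)) (k + 1) z : (Matrix n n ℂ)ˣ) : Matrix n n ℂ) = cornerLog L k u z)

include hv0 in
/-- at such a state the effective corner logarithm IS the linearised accumulated frame of the chart: `h̃(u) = framePotW X(u)`. [folklore] -/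
theorem effCornerLog_eq_framePotW_of_mlog_vcov_eq (z : Site d) : effCornerLog L k W U' u z = framePotW L (k + 1) W (repLog W U' u) z := by
  simp only [effCornerLog, frameDefect, hv0 z, sub_sub_cancel]

include hL hWu hx hs hWx hWP hU'u hU'P hu huP hgauge hX8 hv0 in
/-- **`φ̃(u) = QbarIter L (k+1) W X(u)`** at a state with (1.37) exactly: the coarse datum on the nonlinear target IS [B8]'s linearised double-bar average of the chart. [folklore] -/
theorem coarseDatumNL_eq_QbarIter_of_mlog_vcov_eq : coarseDatumNL L k W U' u = QbarIter L (k + 1) W (repLog W U' u) := by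
  have hL1 : 1 ≤ L := by omega
  have hXs := repLog_skew hWu U' hU'u hu hgauge hX8
  have hXP : IsPeriodicDir (repLog W U' u) ((tower L N (k + 1) : ℕ) : ℤ) := fun y i μ => repLog_periodic k N U' hWP hU'P huP y i μ
  have hdir := dirIter_eq_QbarIter_add_gaugeDir (M := N) hL1 k hWu hWP hx hs hWx hXs hXP
  have hh : effCornerLog L k W U' u = framePotW L (k + 1) W (repLog W U' u) := funext fun z => effCornerLog_eq_framePotW_of_mlog_vcov_eq k U' hv0 z
  funext z κ
  simp only [coarseDatumNL, hdir, hh, add_sub_cancel_right]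

end Datum

end

end Summit.QuantumFields.BalabanUV.T4Continuum.NE7SliceRepresentativeDbar
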